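import Summits.ABC.ABC.Theorems.IneffectiveSubspaceTowerFourSubLiouvilleConverse
import Summits.ABC.ABC.Theorems.IneffectiveSubspaceTowerFourSubLiouvilleStubTransfer

/-!
# Stub `stub_towerFourIffUniformQuarticThue` of line `Sketch` — crux `DepthCountedABC` (stmt-ABC-14938)

WHAT.  Crux #4 of the route, `TowerFourSubLiouville` (stmt-ABC-1649), is EQUIVALENT to the uniform
binomial quartic Thue statement `∃ η > 0, UniformQuarticThue η` governing the first improvement of the
free exponent `2` on the 5-free cell of crux #5 `DepthCountedABC`:
`TowerFourSubLiouville ↔ ∃ η > 0, ∃ B, ∀ a u v Y Z > 0, a + uY⁴ = vZ⁴ → gcd(uY⁴, vZ⁴) = 1 →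
a·u·v ≤ Z^η → Z ≤ B`.  So the entry-level sub-crux of cell 0 IS crux #4 (stmt-ABC-1649), not a new item.

MECHANISM.  By the landed stubs of stmt-ABC-1649, `TowerFourSubLiouville ↔ ∃ η > 0, UBQ η`
(`stub_cruxGivesUBQ`, `stub_transfer`), where `UBQ η` is the uniform binomial-quartic saving: beyond
some `Z₀`, `v, w, Y > 0`, `gcd(vY, wZ) = 1`, `max(v, w) ≤ Z^η`, `wZ⁴ ≠ vY⁴` force `|wZ⁴ − vY⁴| > Z^η`.
It remains to prove `(∃ η > 0, UBQ η) ↔ (∃ η > 0, UniformQuarticThue η)`, pure bookkeeping: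
* `UBQ η` beyond `Z₀` gives `UniformQuarticThue η` with `B = Z₀` (`towerFourIffUQT_uqt_of_ubq`): a datum
  `a + uY⁴ = vZ⁴` with `a·u·v ≤ Z^η` and `Z > Z₀` has `gcd(uY, vZ) = 1`, `max(u, v) ≤ a·u·v ≤ Z^η`,
  `vZ⁴ ≠ uY⁴`, so the saving gives `Z^η < |vZ⁴ − uY⁴| = a ≤ a·u·v ≤ Z^η`, absurd.
* `UniformQuarticThue η` with bound `B` gives `UBQ η'` for any `η' ≤ min(η/4, 1)` beyond any
  `Z₀ ≥ B⁴ + B + 1` (`towerFourIffUQT_ubq_of_uqt`): if `0 < |wZ⁴ − vY⁴| ≤ Z^η'` then either `wZ⁴ > vY⁴`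
  and the datum `(wZ⁴ − vY⁴, v, w, Y, Z)` has `a·v·w ≤ Z^(3η') ≤ Z^η`, whence `Z ≤ B < Z₀`; or
  `wZ⁴ < vY⁴` and the mirrored datum `(vY⁴ − wZ⁴, w, v, Z, Y)` has `Z⁴ ≤ wZ⁴ < vY⁴ ≤ Z·Y⁴`
  (`v ≤ Z^η' ≤ Z`), so `Z³ < Y⁴` and `a·w·v ≤ Z^(3η') ≤ (Z³)^(η/4) ≤ (Y⁴)^(η/4) = Y^η`, whence `Y ≤ B`
  and `Z ≤ Z³ < Y⁴ ≤ B⁴ < Z₀`.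
Take `η' = min(η/4, 1)` and `Z₀ = B⁴ + B + 1`.

Sources: skeleton `Cruxes/DepthCountedABC/Lines/Sketch.lean` (lead c23), stub
`stub_towerFourIffUniformQuarticThue`.  Ingredients:
`Summit.ABC.ABC.Theorems.TowerFourSubLiouville.stub_cruxGivesUBQ`
(`Theorems/IneffectiveSubspaceTowerFourSubLiouvilleConverse.lean`) and
`Summit.ABC.ABC.Theorems.TowerFourSubLiouville.stub_transfer`
(`Theorems/IneffectiveSubspaceTowerFourSubLiouvilleStubTransfer.lean`), both landed and sorry-free
(crux stmt-ABC-1649, line `fourth-radical-binomial-thue`), and Mathlib (`Nat.Coprime.coprime_dvd_left`,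
`Nat.Coprime.coprime_dvd_right`, `Nat.Coprime.pow`, `Real.rpow_add`, `Real.rpow_mul`, `Real.rpow_natCast`,
`Real.rpow_le_rpow`, `Real.rpow_le_rpow_of_exponent_le`).  No unproved facts.  Deliberately NOT here:
the cell-0 consequences (`cellZero_of_towerFourSubLiouville`, skeleton) and anything about `UBQ` on the
5-free locus only.
-/

-- `Summit.<Summit>.<Problem>` is the mandated summit-side namespace (CONVENTIONS §2); for the
-- single-conjunct summit `ABC` the two coincide, so the duplicate `ABC.ABC` is deliberate.
set_option linter.dupNamespace false

namespace Summit.ABC.ABC.Theorems.DepthCountedABC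

/-- From `gcd(uY⁴, vZ⁴) = 1` to `gcd(uY, vZ) = 1` (`uY ∣ uY⁴`, `vZ ∣ vZ⁴`). [folklore] -/
theorem towerFourIffUQT_coprime_of_coprime_pow {u v Y Z : ℕ}
    (h : Nat.Coprime (u * Y ^ 4) (v * Z ^ 4)) : Nat.Coprime (u * Y) (v * Z) :=
  Nat.Coprime.coprime_dvd_left ⟨Y ^ 3, by ring⟩ (Nat.Coprime.coprime_dvd_right ⟨Z ^ 3, by ring⟩ h)

/-- **`UBQ ⟹ uniform quartic Thue`.**  The uniform binomial-quartic saving `η` beyond `Z₀` gives uniform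
binomial quartic Thue at the same `η` with bound `B = Z₀`: a datum `a + uY⁴ = vZ⁴`, `gcd(uY⁴, vZ⁴) = 1`,
`a·u·v ≤ Z^η` with `Z > Z₀` would have `gcd(uY, vZ) = 1`, `max(u,v) ≤ Z^η`, `vZ⁴ ≠ uY⁴` and hence
`Z^η < |vZ⁴ − uY⁴| = a ≤ a·u·v ≤ Z^η`. [folklore] -/
theorem towerFourIffUQT_uqt_of_ubq {η : ℝ} {Z₀ : ℕ}
    (hU : ∀ v w Y Z : ℕ, Z₀ ≤ Z → 0 < v → 0 < w → 0 < Y → Nat.Coprime (v * Y) (w * Z) →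
      ((max v w : ℕ) : ℝ) ≤ (Z : ℝ) ^ η → w * Z ^ 4 ≠ v * Y ^ 4 →
      (Z : ℝ) ^ η < |((w * Z ^ 4 : ℕ) : ℝ) - ((v * Y ^ 4 : ℕ) : ℝ)|) :
    ∀ a u v Y Z : ℕ, 0 < a → 0 < u → 0 < v → 0 < Y → 0 < Z →
      a + u * Y ^ 4 = v * Z ^ 4 → Nat.Coprime (u * Y ^ 4) (v * Z ^ 4) →
      ((a * u * v : ℕ) : ℝ) ≤ (Z : ℝ) ^ η → Z ≤ Z₀ := by
  intro a u v Y Z ha hu hv hY _hZ hsum hcop hauv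
  by_contra hZB
  have hZ0 : Z₀ ≤ Z := (not_le.mp hZB).le
  have hcop1 : Nat.Coprime (u * Y) (v * Z) := towerFourIffUQT_coprime_of_coprime_pow hcop
  have hmaxN : max u v ≤ a * u * v := by
    have huv : max u v ≤ u * v :=
      max_le (Nat.le_mul_of_pos_right u hv) (Nat.le_mul_of_pos_left v hu)
    calc max u v ≤ u * v := huv
      _ ≤ a * (u * v) := Nat.le_mul_of_pos_left (u * v) ha
      _ = a * u * v := (mul_assoc a u v).symm
  have hmax : ((max u v : ℕ) : ℝ) ≤ (Z : ℝ) ^ η := le_trans (by exact_mod_cast hmaxN) hauv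
  have hlt : u * Y ^ 4 < v * Z ^ 4 := by rw [← hsum]; exact Nat.lt_add_of_pos_left ha
  have hsave := hU u v Y Z hZ0 hu hv hY hcop1 hmax hlt.ne'
  have hcast : ((v * Z ^ 4 : ℕ) : ℝ) = (a : ℝ) + ((u * Y ^ 4 : ℕ) : ℝ) := by exact_mod_cast hsum.symm
  rw [hcast, add_sub_cancel_right, abs_of_nonneg (Nat.cast_nonneg a)] at hsave
  have hale : (a : ℝ) ≤ ((a * u * v : ℕ) : ℝ) := by
    exact_mod_cast le_trans (Nat.le_mul_of_pos_right a hu) (Nat.le_mul_of_pos_right (a * u) hv)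
  linarith

/-- **`uniform quartic Thue ⟹ UBQ`.**  Uniform binomial quartic Thue at `η > 0` with bound `B` gives the
uniform binomial-quartic saving at every exponent `η' ≤ min(η/4, 1)` beyond every `Z₀ ≥ B⁴ + B + 1`:
if `0 < |wZ⁴ − vY⁴| ≤ Z^η'` with `max(v,w) ≤ Z^η'`, then for `wZ⁴ > vY⁴` the datum
`(wZ⁴ − vY⁴, v, w, Y, Z)` has `a·v·w ≤ Z^(3η') ≤ Z^η`, so `Z ≤ B`; for `wZ⁴ < vY⁴` the mirrored datum
`(vY⁴ − wZ⁴, w, v, Z, Y)` has `Z³ < Y⁴` (as `Z⁴ ≤ wZ⁴ < vY⁴ ≤ Z·Y⁴`) and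
`a·w·v ≤ Z^(3η') ≤ (Z³)^(η/4) ≤ Y^η`, so `Y ≤ B` and `Z ≤ Z³ < Y⁴ ≤ B⁴`; both contradict `Z ≥ Z₀`.
[folklore] -/
theorem towerFourIffUQT_ubq_of_uqt {η η' : ℝ} (hη : 0 < η) (hη'1 : η' ≤ 1) (hη'4 : 4 * η' ≤ η)
    {B Z₀ : ℕ} (hZ₀ : B ^ 4 + B + 1 ≤ Z₀)
    (hT : ∀ a u v Y Z : ℕ, 0 < a → 0 < u → 0 < v → 0 < Y → 0 < Z →
      a + u * Y ^ 4 = v * Z ^ 4 → Nat.Coprime (u * Y ^ 4) (v * Z ^ 4) →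
      ((a * u * v : ℕ) : ℝ) ≤ (Z : ℝ) ^ η → Z ≤ B) :
    ∀ v w Y Z : ℕ, Z₀ ≤ Z → 0 < v → 0 < w → 0 < Y → Nat.Coprime (v * Y) (w * Z) →
      ((max v w : ℕ) : ℝ) ≤ (Z : ℝ) ^ η' → w * Z ^ 4 ≠ v * Y ^ 4 →
      (Z : ℝ) ^ η' < |((w * Z ^ 4 : ℕ) : ℝ) - ((v * Y ^ 4 : ℕ) : ℝ)| := by
  intro v w Y Z hZ hv hw hY hcop hmax hne
  have hZpos : 0 < Z := by omega
  have hZr1 : (1 : ℝ) ≤ Z := by exact_mod_cast hZpos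
  have hZr0 : (0 : ℝ) < Z := lt_of_lt_of_le one_pos hZr1
  have hY0 : (0 : ℝ) ≤ Y := Nat.cast_nonneg Y
  have hpow0 : (0 : ℝ) ≤ (Z : ℝ) ^ η' := Real.rpow_nonneg hZr0.le _
  have hvle : (v : ℝ) ≤ (Z : ℝ) ^ η' := le_trans (by exact_mod_cast le_max_left v w) hmax
  have hwle : (w : ℝ) ≤ (Z : ℝ) ^ η' := le_trans (by exact_mod_cast le_max_right v w) hmax
  -- `gcd(vY, wZ) = 1 ⟹ gcd(vY⁴, wZ⁴) = 1` (`vY⁴ ∣ (vY)⁴`, `wZ⁴ ∣ (wZ)⁴`; as in stmt-ABC-1649's files)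
  have hcop4 : Nat.Coprime (v * Y ^ 4) (w * Z ^ 4) :=
    Nat.Coprime.coprime_dvd_left ⟨v ^ 3, by ring⟩
      (Nat.Coprime.coprime_dvd_right ⟨w ^ 3, by ring⟩ (Nat.Coprime.pow 4 4 hcop))
  -- `Z^η' · Z^η' · Z^η' = Z^(3η') ≤ Z^(3η/4) ≤ Z^η`
  have h3 : (Z : ℝ) ^ η' * (Z : ℝ) ^ η' * (Z : ℝ) ^ η' = (Z : ℝ) ^ (3 * η') := by
    rw [← Real.rpow_add hZr0, ← Real.rpow_add hZr0]; congr 1; ring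
  have h3le : (Z : ℝ) ^ (3 * η') ≤ (Z : ℝ) ^ (3 * (η / 4)) :=
    Real.rpow_le_rpow_of_exponent_le hZr1 (by linarith)
  have h34 : (Z : ℝ) ^ (3 * (η / 4)) ≤ (Z : ℝ) ^ η :=
    Real.rpow_le_rpow_of_exponent_le hZr1 (by linarith)
  by_contra hcon
  rw [not_lt] at hcon
  rcases lt_or_gt_of_ne hne with hlt | hgt
  · -- `wZ⁴ < vY⁴`: the mirrored datum `(vY⁴ − wZ⁴, w, v, Z, Y)`
    set a := v * Y ^ 4 - w * Z ^ 4
    have ha : a + w * Z ^ 4 = v * Y ^ 4 := Nat.sub_add_cancel hlt.le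
    have ha0 : 0 < a := Nat.sub_pos_of_lt hlt
    have hcast : ((v * Y ^ 4 : ℕ) : ℝ) = (a : ℝ) + ((w * Z ^ 4 : ℕ) : ℝ) := by exact_mod_cast ha.symm
    have habs : |((w * Z ^ 4 : ℕ) : ℝ) - ((v * Y ^ 4 : ℕ) : ℝ)| = (a : ℝ) := by
      rw [hcast, show ((w * Z ^ 4 : ℕ) : ℝ) - ((a : ℝ) + ((w * Z ^ 4 : ℕ) : ℝ)) = -(a : ℝ) by ring,
        abs_neg, abs_of_nonneg (Nat.cast_nonneg a)]
    have hale : (a : ℝ) ≤ (Z : ℝ) ^ η' := by rw [← habs]; exact hcon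
    -- `v ≤ Z`, so `Z⁴ ≤ wZ⁴ < vY⁴ ≤ Z·Y⁴` and `Z³ < Y⁴`
    have hvZ : v ≤ Z := by
      have h1 : (Z : ℝ) ^ η' ≤ (Z : ℝ) ^ (1 : ℝ) := Real.rpow_le_rpow_of_exponent_le hZr1 hη'1
      rw [Real.rpow_one] at h1
      exact_mod_cast hvle.trans h1
    have hZY : Z ^ 3 < Y ^ 4 := by
      have h1 : Z * Z ^ 3 < Z * Y ^ 4 :=
        calc Z * Z ^ 3 = Z ^ 4 := by ring
          _ ≤ w * Z ^ 4 := Nat.le_mul_of_pos_left _ hw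
          _ < v * Y ^ 4 := hlt
          _ ≤ Z * Y ^ 4 := Nat.mul_le_mul_right _ hvZ
      exact lt_of_mul_lt_mul_left h1 (Nat.zero_le Z)
    have hZYr : (Z : ℝ) ^ (3 : ℕ) ≤ (Y : ℝ) ^ (4 : ℕ) := by exact_mod_cast hZY.le
    have hbound : ((a * w * v : ℕ) : ℝ) ≤ (Y : ℝ) ^ η := by
      push_cast
      calc (a : ℝ) * w * v ≤ (Z : ℝ) ^ η' * (Z : ℝ) ^ η' * (Z : ℝ) ^ η' :=
            mul_le_mul (mul_le_mul hale hwle (Nat.cast_nonneg w) hpow0) hvle (Nat.cast_nonneg v)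
              (mul_nonneg hpow0 hpow0)
        _ = (Z : ℝ) ^ (3 * η') := h3
        _ ≤ (Z : ℝ) ^ (3 * (η / 4)) := h3le
        _ = ((Z : ℝ) ^ (3 : ℕ)) ^ (η / 4) := by
            rw [Real.rpow_mul hZr0.le, ← Real.rpow_natCast (Z : ℝ) 3]; norm_num
        _ ≤ ((Y : ℝ) ^ (4 : ℕ)) ^ (η / 4) := Real.rpow_le_rpow (by positivity) hZYr (by linarith)
        _ = (Y : ℝ) ^ η := by
            rw [← Real.rpow_natCast (Y : ℝ) 4, ← Real.rpow_mul hY0]; congr 1; push_cast; ring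
    have hYB : Y ≤ B := hT a w v Z Y ha0 hw hv hZpos hY ha hcop4.symm hbound
    have hY4 : Y ^ 4 ≤ B ^ 4 := Nat.pow_le_pow_left hYB 4
    have hZ3 : Z ≤ Z ^ 3 := Nat.le_self_pow (by norm_num) Z
    omega
  · -- `vY⁴ < wZ⁴`: the datum `(wZ⁴ − vY⁴, v, w, Y, Z)` itself
    set a := w * Z ^ 4 - v * Y ^ 4
    have ha : a + v * Y ^ 4 = w * Z ^ 4 := Nat.sub_add_cancel hgt.le
    have ha0 : 0 < a := Nat.sub_pos_of_lt hgt
    have hcast : ((w * Z ^ 4 : ℕ) : ℝ) = (a : ℝ) + ((v * Y ^ 4 : ℕ) : ℝ) := by exact_mod_cast ha.symm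
    have habs : |((w * Z ^ 4 : ℕ) : ℝ) - ((v * Y ^ 4 : ℕ) : ℝ)| = (a : ℝ) := by
      rw [hcast, add_sub_cancel_right, abs_of_nonneg (Nat.cast_nonneg a)]
    have hale : (a : ℝ) ≤ (Z : ℝ) ^ η' := by rw [← habs]; exact hcon
    have hbound : ((a * v * w : ℕ) : ℝ) ≤ (Z : ℝ) ^ η := by
      push_cast
      calc (a : ℝ) * v * w ≤ (Z : ℝ) ^ η' * (Z : ℝ) ^ η' * (Z : ℝ) ^ η' :=
            mul_le_mul (mul_le_mul hale hvle (Nat.cast_nonneg v) hpow0) hwle (Nat.cast_nonneg w)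
              (mul_nonneg hpow0 hpow0)
        _ = (Z : ℝ) ^ (3 * η') := h3
        _ ≤ (Z : ℝ) ^ (3 * (η / 4)) := h3le
        _ ≤ (Z : ℝ) ^ η := h34
    have hZle : Z ≤ B := hT a v w Y Z ha0 hv hw hY hZpos ha hcop4 hbound
    omega

/-- **Stub `stub_towerFourIffUniformQuarticThue` of line `Sketch`, crux `DepthCountedABC` (stmt-ABC-14938):
crux #4 `TowerFourSubLiouville` (stmt-ABC-1649) is equivalent to uniform binomial quartic Thue for SOME
`η > 0`** — the positive coprime solutions of `a + u·Y⁴ = v·Z⁴` with `a·u·v ≤ Z^η` have uniformly bounded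
`Z`.  Composition of the landed `stub_cruxGivesUBQ` / `stub_transfer` of stmt-ABC-1649
(`TowerFourSubLiouville ↔ ∃ η > 0, UBQ η`) with the bookkeeping `towerFourIffUQT_uqt_of_ubq` /
`towerFourIffUQT_ubq_of_uqt` (`UBQ η ⟹ UQT η`, `UQT η ⟹ UBQ (min (η/4) 1)`). [folklore] -/
theorem stub_towerFourIffUniformQuarticThue :
    Summit.ABC.ABC.Theses.IneffectiveSubspace.TowerFourSubLiouville ↔
    ∃ η : ℝ, 0 < η ∧ ∃ B : ℕ, ∀ a u v Y Z : ℕ, 0 < a → 0 < u → 0 < v → 0 < Y → 0 < Z →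
      a + u * Y ^ 4 = v * Z ^ 4 → Nat.Coprime (u * Y ^ 4) (v * Z ^ 4) →
      ((a * u * v : ℕ) : ℝ) ≤ (Z : ℝ) ^ η → Z ≤ B := by
  constructor
  · intro h4
    obtain ⟨η, hη, Z₀, hU⟩ := Summit.ABC.ABC.Theorems.TowerFourSubLiouville.stub_cruxGivesUBQ h4
    exact ⟨η, hη, Z₀, towerFourIffUQT_uqt_of_ubq hU⟩
  · rintro ⟨η, hη, B, hT⟩
    exact Summit.ABC.ABC.Theorems.TowerFourSubLiouville.stub_transfer
      ⟨min (η / 4) 1, lt_min (by linarith) one_pos, B ^ 4 + B + 1,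
        towerFourIffUQT_ubq_of_uqt hη (min_le_right _ _)
          (by linarith [min_le_left (η / 4) 1]) le_rfl hT⟩

end Summit.ABC.ABC.Theorems.DepthCountedABC
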